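import Mathlib
import Summits.KontsevichZagierPeriods.KontsevichZagierPeriods.Theorems.SoloInformedWallFaces
import Summits.KontsevichZagierPeriods.KontsevichZagierPeriods.Theorems.SoloInformedPresRat
import Summits.KontsevichZagierPeriods.KontsevichZagierPeriods.Theorems.SoloInformedVolumeCube
import Summits.KontsevichZagierPeriods.KontsevichZagierPeriods.Theorems.SoloInformedKZPUpToPairs
import HarnessLib
import HarnessLib.Audit

/-!
# SoloInformed — the wall one index lower, in SOLIDS currency: faces of the truncations `KZPUpTo n`

Solo programme `solo-KontsevichZagierPeriods-informed`, session s117 (written) / s196 (checked and landed,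
once the imported cone had hub oleans).  Companion of `SoloInformedKZPUpToWall` / `SoloInformedKZPUpToPairs`
(the same faces in CERTIFICATE currency, on the rational representations themselves): here the
certificates are the SOLID ones of `SoloInformedWallFaces` (`a·[E_q] − b·[[0,1]ⁿ⁺¹]`, volumes of
`ℚ`-semialgebraic solids), reached from the rational representation by ONE Newton–Leibniz move.

The summit is the conjunction of its truncations `SoloInformedKZPUpTo N` — "any two *rational*
integral representations (`[σ, P/Q]`, `P, Q ∈ ℚ[x]`, `Q` zero-free on `σ`, KZ's literal shape
`IntegralRep.IsRational`) of dimensions `≤ N` with the same value are KZ-equivalent"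
(`soloInformed_kzp_iff_forall_kzpUpTo`, file `SoloInformedPresRat`).  The truncation `N = 1` is a
theorem of the tree (`soloInformed_kzpUpTo_one`, Baker); `N = 2` holds granting Ayoub's conjecture up
to torsion (`soloInformed_kzpUpTo_two_of_ayoubKZeffQ`).  This file records, in kernel form, what the
first UNDECIDED truncations already contain, one index LOWER than the volume ladder of
`SoloInformedWallFaces` (`Rung_{n+1} → (NoRel ↔ vol ∉ ℚ)`): the solid `E_q ⊂ [0,1]ⁿ⁺¹` under the
graph of `1/q` (`q ∈ ℚ[x₀,…,x_{n−1}]`, `q ≥ 1` on the cube) is ONE Newton–Leibniz move away from the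
`n`-dimensional rational representation `[[0,1]ⁿ, 1/q]` (`soloInformed_subgraphRep_equivalent`), and
the unit cubes of consecutive dimensions are one Newton–Leibniz move apart
(`soloInformed_unitCubeRep_succ_sub_mem_relations`).  Hence

* (`soloInformed_kzpUpTo_subgraphNoRelation_iff`) **`KZPUpTo n → (NoRel(q) ↔ vol E_q ∉ ℚ)`**, where
  `NoRel(q)` is the statement of `SoloInformedWallFaces`: no positive integers `a, b` give a move
  certificate `a·[E_q] − b·[[0,1]ⁿ⁺¹] ∈ relations`.  The truncation is applied ONCE, to the two
  rational representations `[[0,1]ⁿ, a/q]` and `[[0,1]ⁿ, b]` of dimension `n`;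
* (`soloInformed_kzpUpTo_etaNoRelation_iff`) **`KZPUpTo n → (NoRel(η_n) ↔ ζ(n) ∉ ℚ)`** (`n ≥ 2`), in
  particular (`soloInformed_kzpUpTo_five_etaFiveNoRelation_iff_zetaFiveIrrational`)
  **`KZPUpTo 5 → (SoloInformedEtaFiveNoRelation ↔ ZetaFiveIrrational)`**;
* (`soloInformed_kzpUpTo_two_catalanNoRelation_iff_catalanIrrational`)
  **`KZPUpTo 2 → (SoloInformedCatalanNoRelation ↔ CatalanIrrational)`** — a face of the FIRST
  undecided truncation: Catalan's constant is `∫_{[0,1]²} dx dy/(1 + x²y²)`, a rational representation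
  of dimension two.

So between the theorem `KZPUpTo 1` and the first undecided truncation `KZPUpTo 2` lies, on the
calculus side, exactly the certificate statement `NoRel(G)` (which the residency's paper proves from
the weight grading of the formal period algebra granting that the moves are motivic — outside the
kernel), and on the arithmetic side the irrationality of Catalan's constant (OPEN).  Neither ladder
(`Rung_d`: equal volumes; `KZPUpTo N`: equal values of rational integrands) cheaply implies the other
at a fixed index; both exhaust the summit (`soloInformed_kontsevichZagierPeriods_iff_forall_rung`,
`soloInformed_kzp_iff_forall_kzpUpTo`).

References: M. Kontsevich, D. Zagier, *Periods* (2001), §1.1–1.2; M. Waldschmidt, *Open Diophantine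
problems*, Moscow Math. J. 4 (2004), §3 (irrationality of Catalan's constant and of `ζ(5)` open);
T. Rivoal, W. Zudilin, *Diophantine properties of numbers related to Catalan's constant*,
Math. Ann. 326 (2003).
-/

noncomputable section

open MeasureTheory Set Filter
open scoped Topology

namespace Summit.KontsevichZagierPeriods.KontsevichZagierPeriods.Theorems

open Literature.NumberTheory.Transcendental Literature.NumberTheory.Transcendental.KZ

variable {n : ℕ}

/-! ### Two one-move lemmas -/

/-- **`[[0,1]ⁿ⁺¹, 1] ∼ [[0,1]ⁿ, 1]`**: the unit cubes of consecutive dimensions differ by a relation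
(the cube `[0,1]ⁿ⁺¹` is the solid `E_1` under the graph of `1/1`; one Newton–Leibniz move).
[Kontsevich–Zagier 2001, §1.2 rule (3)] -/
theorem soloInformed_unitCubeRep_succ_sub_mem_relations (n : ℕ) :
    of (soloInformedUnitCubeRep (n + 1)) - of (soloInformedUnitCubeRep n) ∈ relations := by
  have h1 : ∀ x ∈ KZ.cube n, (1 : ℝ) ≤ MvPolynomial.aeval x (1 : MvPolynomial (Fin n) ℚ) := by
    intro x _
    simp
  have hS : of (soloInformedSubgraphRep 1 h1) - of (soloInformedRecipRep 1 h1) ∈ relations :=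
    soloInformed_subgraphRep_equivalent 1 h1
  have hA : of (soloInformedUnitCubeRep (n + 1)) - of (soloInformedSubgraphRep 1 h1) ∈ relations := by
    refine soloInformed_of_sub_of_mem_relations_of_eqOn _ _ ?_ (fun x _ => by
      simp [soloInformedUnitCubeRep])
    ext z
    show (∀ i, 0 ≤ z i ∧ z i ≤ 1) ↔
      ((∀ i, 0 ≤ Fin.init z i ∧ Fin.init z i ≤ 1) ∧ 0 ≤ z (Fin.last n) ∧
        z (Fin.last n) * MvPolynomial.aeval (Fin.init z) (1 : MvPolynomial (Fin n) ℚ) ≤ 1)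
    simp only [map_one, mul_one, Fin.init, Fin.forall_fin_succ']
  have hB : of (soloInformedRecipRep 1 h1) - of (soloInformedUnitCubeRep n) ∈ relations :=
    soloInformed_of_sub_of_mem_relations_of_eqOn _ _ rfl (fun x _ => by
      simp [soloInformedUnitCubeRep])
  have e : of (soloInformedUnitCubeRep (n + 1)) - of (soloInformedUnitCubeRep n) =
      (of (soloInformedUnitCubeRep (n + 1)) - of (soloInformedSubgraphRep 1 h1)) +
        (of (soloInformedSubgraphRep 1 h1) - of (soloInformedRecipRep 1 h1)) +
        (of (soloInformedRecipRep 1 h1) - of (soloInformedUnitCubeRep n)) := by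
    abel
  rw [e]
  exact relations.add_mem (relations.add_mem hA hS) hB

/-- All unit cubes are equivalent to the point `[[0,1]⁰, 1]`. -/
theorem soloInformed_unitCubeRep_sub_unitCubeRep_zero_mem_relations (d : ℕ) :
    of (soloInformedUnitCubeRep d) - of (soloInformedUnitCubeRep 0) ∈ relations := by
  induction d with
  | zero => simp [relations.zero_mem]
  | succ d ih =>
    have e : of (soloInformedUnitCubeRep (d + 1)) - of (soloInformedUnitCubeRep 0) =
        (of (soloInformedUnitCubeRep (d + 1)) - of (soloInformedUnitCubeRep d)) +
          (of (soloInformedUnitCubeRep d) - of (soloInformedUnitCubeRep 0)) := by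
      abel
    rw [e]
    exact relations.add_mem (soloInformed_unitCubeRep_succ_sub_mem_relations d) ih

/-- `[[0,1]ⁿ, c]` (`c ∈ ℚ`) has KZ's literal rational shape. -/
theorem soloInformed_constMulRep_unitCubeRep_isRational (n : ℕ) (c : ℚ) :
    (soloInformedConstMulRep (soloInformedUnitCubeRep n) c).IsRational :=
  ⟨MvPolynomial.C c, 1, fun _ _ => by simp, fun x _ => by
    simp [soloInformedConstMulRep, soloInformedUnitCubeRep]⟩

/-! ### Generic: the truncation `KZPUpTo n` decides the certificates for `E_q`, `q ∈ ℚ[x₀,…,x_{n−1}]` -/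

section Generic

variable (q : MvPolynomial (Fin n) ℚ) (hq : ∀ x ∈ KZ.cube n, (1 : ℝ) ≤ MvPolynomial.aeval x q)

/-- `[[0,1]ⁿ, c/q]` (`c ∈ ℚ`) has KZ's literal rational shape. -/
theorem soloInformed_constMulRep_recipRep_isRational (c : ℚ) :
    (soloInformedConstMulRep (soloInformedRecipRep q hq) c).IsRational :=
  ⟨MvPolynomial.C c, q, fun _ hx => (soloInformed_aeval_pos_of_mem_cube q hq hx).ne', fun x _ => by
    simp [soloInformedConstMulRep, div_eq_mul_inv]⟩

/-- **The truncation produces the certificate.** Under `KZPUpTo n`: if `a · vol E_q = b` then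
`a·[E_q] − b·[[0,1]ⁿ⁺¹] ∈ relations` — apply the truncation to the two `n`-dimensional rational
representations `[[0,1]ⁿ, a/q]` and `[[0,1]ⁿ, b]` (equal values), and move back with integrand
additivity (`c·[D, f] ∼ [D, c f]`), the Newton–Leibniz move `[E_q] ∼ [[0,1]ⁿ, 1/q]` and
`[[0,1]ⁿ⁺¹] ∼ [[0,1]ⁿ]`. -/
theorem soloInformed_kzpUpTo_nsmul_subgraph_sub_mem_relations (h : SoloInformedKZPUpTo n) (a b : ℕ)
    (hv : (a : ℝ) * (soloInformedSubgraphRep q hq).value = b) :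
    a • of (soloInformedSubgraphRep q hq) - b • of (soloInformedUnitCubeRep (n + 1)) ∈ relations := by
  have hval : (soloInformedConstMulRep (soloInformedRecipRep q hq) (a : ℚ)).value =
      (soloInformedConstMulRep (soloInformedUnitCubeRep n) (b : ℚ)).value := by
    rw [soloInformed_value_constMulRep, soloInformed_value_constMulRep, soloInformed_value_unitCubeRep,
      mul_one, Rat.cast_natCast, Rat.cast_natCast, ← hv, soloInformed_value_subgraphRep]
    rfl
  have hE : of (soloInformedConstMulRep (soloInformedRecipRep q hq) (a : ℚ)) -
      of (soloInformedConstMulRep (soloInformedUnitCubeRep n) (b : ℚ)) ∈ relations :=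
    h _ _ le_rfl le_rfl (soloInformed_constMulRep_recipRep_isRational q hq a)
      (soloInformed_constMulRep_unitCubeRep_isRational n b) hval
  have h1 : of (soloInformedSubgraphRep q hq) - of (soloInformedRecipRep q hq) ∈ relations :=
    soloInformed_subgraphRep_equivalent q hq
  have h2 := soloInformed_nsmul_of_sub_of_constMulRep (soloInformedRecipRep q hq) a
  have h3 := soloInformed_nsmul_of_sub_of_constMulRep (soloInformedUnitCubeRep n) b
  have h4 := soloInformed_unitCubeRep_succ_sub_mem_relations n
  have e : a • of (soloInformedSubgraphRep q hq) - b • of (soloInformedUnitCubeRep (n + 1)) =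
      a • (of (soloInformedSubgraphRep q hq) - of (soloInformedRecipRep q hq)) +
        (a • of (soloInformedRecipRep q hq) -
          of (soloInformedConstMulRep (soloInformedRecipRep q hq) (a : ℚ))) +
        (of (soloInformedConstMulRep (soloInformedRecipRep q hq) (a : ℚ)) -
          of (soloInformedConstMulRep (soloInformedUnitCubeRep n) (b : ℚ))) -
        (b • of (soloInformedUnitCubeRep n) -
          of (soloInformedConstMulRep (soloInformedUnitCubeRep n) (b : ℚ))) -
        b • (of (soloInformedUnitCubeRep (n + 1)) - of (soloInformedUnitCubeRep n)) := by
    simp only [smul_sub]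
    abel
  rw [e]
  exact relations.sub_mem (relations.sub_mem (relations.add_mem (relations.add_mem
    (relations.nsmul_mem h1 a) h2) hE) h3) (relations.nsmul_mem h4 b)

/-- **`KZPUpTo n → (NoRel(q) ↔ vol E_q ∉ ℚ)`**: under the period conjecture for rational
representations of dimensions `≤ n`, the irrationality of `vol E_q = ∫_{[0,1]ⁿ} dx/q` is exactly the
non-existence of a move certificate `a·[E_q] − b·[[0,1]ⁿ⁺¹] ∈ relations` with `a, b ≥ 1` — one
index below `soloInformed_rung_subgraphNoRelation_iff`. -/
theorem soloInformed_kzpUpTo_subgraphNoRelation_iff (h : SoloInformedKZPUpTo n) :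
    (∀ a b : ℕ, a ≠ 0 → b ≠ 0 →
        a • of (soloInformedSubgraphRep q hq) - b • of (soloInformedUnitCubeRep (n + 1)) ∉ relations) ↔
      Irrational (soloInformedSubgraphRep q hq).value := by
  refine ⟨fun hno => ?_, fun hirr a b ha _ =>
    soloInformed_nsmul_subgraph_sub_not_mem_relations_of_irrational q hq hirr a b ha⟩
  by_contra hrat
  obtain ⟨r, hr⟩ : (soloInformedSubgraphRep q hq).value ∈ Set.range ((↑) : ℚ → ℝ) :=
    not_not.1 hrat
  have hpos := soloInformed_value_subgraphRep_pos q hq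
  have hr0 : 0 < r := by
    rw [← hr] at hpos
    exact_mod_cast hpos
  have hnum : 0 < r.num := Rat.num_pos.2 hr0
  have hcast : ((r.num.toNat : ℕ) : ℝ) = (r.num : ℝ) := by
    rw [← Int.cast_natCast, Int.toNat_of_nonneg hnum.le]
  have hden : (r.den : ℝ) ≠ 0 := by exact_mod_cast r.den_nz
  refine hno r.den r.num.toNat r.den_nz (by omega)
    (soloInformed_kzpUpTo_nsmul_subgraph_sub_mem_relations q hq h _ _ ?_)
  rw [hcast, ← hr, Rat.cast_def]
  field_simp

end Generic

/-! ### Face 1: `ζ(n)` and the truncation `KZPUpTo n` -/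

/-- **`KZPUpTo n → (NoRel(η_n) ↔ ζ(n) ∉ ℚ)`** (`n ≥ 2`): under the period conjecture for rational
representations of dimensions `≤ n`, the irrationality of `ζ(n)` is exactly the non-existence of a
move certificate `a·[E_η(n)] − b·[[0,1]ⁿ⁺¹] ∈ relations` (`a, b ≥ 1`), `E_η(n)` the solid under the
graph of `1/(1 + x₀⋯x_{n−1})`, of volume `(1 − 2^{1−n}) ζ(n)`. -/
theorem soloInformed_kzpUpTo_etaNoRelation_iff (hn : 2 ≤ n) (h : SoloInformedKZPUpTo n) :
    (∀ a b : ℕ, a ≠ 0 → b ≠ 0 →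
        a • of (soloInformedEtaSolid n) - b • of (soloInformedUnitCubeRep (n + 1)) ∉ relations) ↔
      Irrational (zetaValue n) := by
  have e := soloInformed_kzpUpTo_subgraphNoRelation_iff (soloInformedEtaPoly n)
    (soloInformed_etaPoly_ge_one n) h
  have hv : (soloInformedSubgraphRep (soloInformedEtaPoly n) (soloInformed_etaPoly_ge_one n)).value =
      (1 - 2 / 2 ^ n) * zetaValue n := soloInformed_value_etaSolid hn
  rw [hv, soloInformed_irrational_factor_mul_zetaValue_iff hn] at e
  exact e

/-- **Face of the truncation `N = 5`: `KZPUpTo 5 → (NoRel(η₅) ↔ ζ(5) ∉ ℚ)`** — `ζ(5) ∉ ℚ` is OPEN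
(`ZetaFiveIrrational`). -/
theorem soloInformed_kzpUpTo_five_etaFiveNoRelation_iff_zetaFiveIrrational (h : SoloInformedKZPUpTo 5) :
    SoloInformedEtaFiveNoRelation ↔ ZetaFiveIrrational :=
  soloInformed_kzpUpTo_etaNoRelation_iff (n := 5) (by norm_num) h

/-- The truncation `N = 3` produces Apéry's certificate statement for free: under `KZPUpTo 3` the
(unconditionally true, `soloInformed_eta_three_not_mem_relations`) statement `NoRel(η₃)` is
equivalent to `ζ(3) ∉ ℚ` (Apéry's theorem, tree `irrational_zetaValue_three_holds`). -/
theorem soloInformed_kzpUpTo_three_etaNoRelation_iff (h : SoloInformedKZPUpTo 3) :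
    (∀ a b : ℕ, a ≠ 0 → b ≠ 0 →
        a • of (soloInformedEtaSolid 3) - b • of (soloInformedUnitCubeRep 4) ∉ relations) ↔
      Irrational (zetaValue 3) :=
  soloInformed_kzpUpTo_etaNoRelation_iff (n := 3) (by norm_num) h

/-! ### Face 2: Catalan's constant and the FIRST undecided truncation `KZPUpTo 2` -/

/-- **Face of the first undecided truncation: `KZPUpTo 2 → (NoRel(G) ↔ CatalanIrrational)`.**
Under the period conjecture for rational integral representations of dimensions `≤ 2`, the
irrationality of Catalan's constant `G = ∫_{[0,1]²} dx dy/(1 + x²y²)` (OPEN) is exactly the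
non-existence of a move certificate `a·[E_G] − b·[[0,1]³] ∈ relations` with `a, b ≥ 1`. -/
theorem soloInformed_kzpUpTo_two_catalanNoRelation_iff_catalanIrrational (h : SoloInformedKZPUpTo 2) :
    SoloInformedCatalanNoRelation ↔ CatalanIrrational := by
  have e := soloInformed_kzpUpTo_subgraphNoRelation_iff soloInformedCatalanPoly
    soloInformed_catalanPoly_ge_one h
  have hv : (soloInformedSubgraphRep soloInformedCatalanPoly soloInformed_catalanPoly_ge_one).value =
      catalanConstant := soloInformed_value_catalanSolid
  rw [hv] at e
  exact e

/-- The same face read through the conditional truncation theorem of the tree: granting Ayoub's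
conjecture up to torsion (`SoloInformedAyoubKZeffQ`, which gives `KZPUpTo 2` by
`soloInformed_kzpUpTo_two_of_ayoubKZeffQ` — not imported here, so the truncation is taken as the
hypothesis), `NoRel(G) ↔ G ∉ ℚ`; and every truncation `N ≥ 2` decides the Catalan face
(monotonicity `soloInformed_kzpUpTo_mono`). -/
theorem soloInformed_kzpUpTo_catalanNoRelation_iff_catalanIrrational {N : ℕ} (hN : 2 ≤ N)
    (h : SoloInformedKZPUpTo N) : SoloInformedCatalanNoRelation ↔ CatalanIrrational :=
  soloInformed_kzpUpTo_two_catalanNoRelation_iff_catalanIrrational (soloInformed_kzpUpTo_mono hN h)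

end Summit.KontsevichZagierPeriods.KontsevichZagierPeriods.Theorems
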